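import Summits.BirchSwinnertonDyer.Rank1Residual.X2.ResidualSelmerFinite
import HarnessLib

/-!
# Everywhere-unramified classes of a SUB-module are Greenberg–Selmer classes for EVERY ordinary
# datum — the Φ-side inclusion `i_* S^{Σ₀}_Φ(L) ⊆ S^{Σ₀}_M(L)` of the type-A devissage, and its
# exactness for a rational line UNRAMIFIED at `p` (route `EisensteinPrimes`, cruxes 3 / 5, line
# `mudescent`, stub `stub_lambdaCount_offLocus`, ALGEBRAIC conjunct; seat bsd-eis-lam-b g0, PART 1b (5))

HONEST FRAMING (cell `bsd-eis`, programme §HONESTY: no tranche here proves BSD; this file moves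
nothing between columns): THEOREMS ONLY — no definition, no named fact, nothing asserted about any
curve, closes nothing. A HELPER for the item OWNER (skeletons bcae135b… / d113fc0a…, ky g7).

WHY (this seat's MEMO `HOME/lam-b-MEMO-1.md`, §3/§5). At the étale end `W₀` of a type-A
(`¬ GVPar`) class the rational line `Φ₀ ≤ E[p]` is UNRAMIFIED at `p` (and even), so `Φ₀ ∩ C[p] = 0`
and `Φ₀ ≅ E[p]/C[p]` (tree: `ResidualSelmerFinite.torsionDatum_plus_inf_lineSub_eq_bot`,
`bijective_grMk_incl_of_lineUnramifiedAt`); the quotient `Ψ` is ramified-ODD, its relaxed Selmer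
group has `(Λ/p)`-corank `1` (Greenberg, LNM 1716, Lemma 5.9) and the tree's case-2 finiteness
theorem `finite_gvSelmer_torsion_of_lineUnramifiedAt` is then VACUOUS-BY-HYPOTHESIS
(`[Finite (unramifiedOutside H Ψ p S₀)]` fails). What survives on the algebraic side is the
Φ-SIDE: classes of `H¹(ℚ_Σ/ℚ_∞, Φ₀)` unramified at `p` inject into the residual Selmer group
`S^{Σ₀}_{E[p]}(ℚ_∞)` — GV's devissage read on the SUB instead of the quotient. This file proves
that inclusion, for ARBITRARY Greenberg data (so for the reduction datum at good ordinary `p` and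
the Tate datum at `p ‖ N` alike), and its exactness (the Φ-classes that land in the Selmer group are
EXACTLY the `p`-unramified ones) when `Φ₀` is unramified at `p`. The count-to-`λ` conversion
(`dim_{𝔽_p} S^{Σ₀}_{E[p]}(ℚ_∞) = λ + Σδ` at `μ = 0`, GV Prop. (2.8) / tree
`NonPrimitiveSelmerCorank`) is NOT touched: it needs `μ(W₀) = 0` as an input (MEMO §5).

WHAT.
* §1 (generic: number field `K`, normal `H ≤ Γ_K` with fixed field `L`, discrete `Γ_K`-modules,
  ANY Greenberg data `N` on `M` above `p`, any `S₀`):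
  `unramifiedKer_le_greenbergKer` — a class unramified at `v ∣ p` satisfies Greenberg's condition at
  `v` for EVERY local datum (`res_{I_v} c = 0 ⇒` its image in `H¹(H ⊓ I_v, M/M⁺_v)` is `0`);
  `quotSelmer_le_datumSelmer` — `H¹_unr(ℚ_Σ/L, M) ⊆ S^{Σ₀}_M(L)` for every datum (GV p. 29
  "`S_A(ℚ_∞) = H¹_unr`" is the case `M⁺ = 0`; in general `⊇`);
  `subH1_mem_quotSelmer` — `i_*` preserves "unramified everywhere outside `S₀`";
  **`subH1_mem_datumSelmer_of_mem_quotSelmer`** — `i_* S^{Σ₀}_Φ(L) ⊆ S^{Σ₀}_M(L)` for an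
  equivariant `i : Φ → M` and ANY datum on `M` (contrast the tree's case-1 lemma
  `ResidualDevissageSelmer.subH1_mem_datumSelmer`, which needs `im i ⊆ M⁺_v = ker q`);
  `subH1_mem_datumSelmer_iff_of_bijective` — if `Φ → M/M⁺_v` is bijective at every `v ∣ p` then
  for `a ∈ H¹(ℚ_Σ/L, Φ)`: `i_* a ∈ S^{Σ₀}_M(L) ↔ a ∈ S^{Σ₀}_Φ(L)` (with the tree's
  `mem_unramifiedKer_of_subH1_mem_greenbergKer`).
* §2 (`E/ℚ`, a rational line `Φ₀ ≤ E[p]`, Greenberg data `L` on `E[p^∞]`, the residual data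
  `torsionData L p` on `E[p]`, GV's `gvSelmer`): `incl_mem_gvSelmer_of_mem_quotSelmer` (any line,
  any data) and **`incl_mem_gvSelmer_iff_of_lineUnramifiedAt`** (line UNRAMIFIED at `p`, data with
  residual line of order `p` inertially generated — the reduction datum at good ordinary `p > 2` and
  the Tate datum at `p ‖ N` both qualify, as in `ResidualSelmerFinite`): the Φ₀-classes inside
  `S^{Σ₀}_{E[p]}(L)` are EXACTLY `S^{Σ₀}_{Φ₀}(L) = H¹_unr`.

References: Greenberg–Vatsal, Invent. Math. 142 (2000) §2 pp. 16–17, 20, 28–30; Greenberg, LNM 1716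
(1999) Lemma 5.9, Prop. 5.10 (proof, PDF pp. 147–148); HOME/lam-b-MEMO-1.md §3, §5.
-/

set_option autoImplicit false
-- `Summit.BirchSwinnertonDyer.BirchSwinnertonDyer.…`: the summit and its single sub-problem share a name (D-0017 layout).
set_option linter.dupNamespace false

noncomputable section

open scoped Classical AddSubgroup

universe u

namespace Summit.BirchSwinnertonDyer.BirchSwinnertonDyer.Theorems.EisensteinPrimesUnramifiedLineSelmerClasses

open Literature.NumberTheory.EllipticCurves Literature.NumberTheory.GaloisRepresentations
open NumberField IsDedekindDomain Field
open Literature.NumberTheory.EllipticCurves.GreenbergSelmer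
open Literature.NumberTheory.EllipticCurves.GreenbergVatsal2000 hiding unramifiedKer
open Summit.BirchSwinnertonDyer.Rank1Residual.X2.ResidualDevissage
open Summit.BirchSwinnertonDyer.Rank1Residual.X2.ResidualDevissageSelmer
open Summit.BirchSwinnertonDyer.Rank1Residual.X2.ResidualSelmerFinite

/-! ## §1. Generic: everywhere-unramified classes and Greenberg's condition -/

section NumberField

variable {K : Type u} [Field K] [NumberField K]
variable {H : Subgroup (absoluteGaloisGroup K)} [H.Normal]
variable {Φ : Type u} [AddCommGroup Φ] [DistribMulAction (absoluteGaloisGroup K) Φ]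
  [TopologicalSpace Φ] [DiscreteTopology Φ]
variable {M : Type u} [AddCommGroup M] [DistribMulAction (absoluteGaloisGroup K) M]
  [TopologicalSpace M] [DiscreteTopology M]
variable {i : Φ →+ M} {hi : ∀ (g : absoluteGaloisGroup K) (x : Φ), i (g • x) = g • i x}
variable {p : ℕ} {N : Data K M p} {S₀ : Set (HeightOneSpectrum (𝓞 K))}

omit [H.Normal] in
/-- **A class unramified at `v` satisfies Greenberg's condition at `v` for EVERY local datum**:
Greenberg's map `H¹(H, M) → H¹(H ⊓ I_v, M/M⁺_v)` factors through the restriction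
`H¹(H, M) → H¹(H ⊓ I_v, M)` (`resH1Hom_comp`). [cite: GreenbergVatsal2000, §2 pp. 16–17] -/
theorem unramifiedKer_le_greenbergKer {v : HeightOneSpectrum (𝓞 K)} (N : LocalDatum K M v) :
    GreenbergVatsal2000.unramifiedKer H M v ≤ N.greenbergKer H := by
  intro c hc
  have hcomp : (resH1Hom (ContinuousMonoidHom.id (inertiaIn H v)) N.grMk
        (fun x m ↦ by
          change N.grMk (((x : decomp v) : absoluteGaloisGroup K) • m) = (x : decomp v) • N.grMk m
          rw [LocalDatum.smul_grMk])).comp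
        (resH1Hom (inertiaInToH H v) (AddMonoidHom.id M) (fun _ _ ↦ rfl)) = N.greenbergMap H := by
    rw [LocalDatum.greenbergMap, resH1Hom_comp]
    exact resH1Hom_congr (by ext; rfl) (by ext; rfl) _ _
  rw [GreenbergVatsal2000.unramifiedKer, AddMonoidHom.mem_ker] at hc
  rw [LocalDatum.mem_greenbergKer_iff, ← hcomp, AddMonoidHom.comp_apply, hc, map_zero]

/-- **`H¹_unr ⊆ S^{Σ₀}_M(L)` for every datum**: a class unramified at every finite place outside
`S₀` (the tree's `quotSelmer H M p S₀`, GV p. 29 "`H¹_unr(ℚ_Σ/ℚ_∞, A)`") lies in the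
Greenberg–Vatsal Selmer group of ANY ordinary data `N` above `p`. [cite: GreenbergVatsal2000, §2 pp. 20, 29] -/
theorem quotSelmer_le_datumSelmer : quotSelmer H M p S₀ ≤ datumSelmer H M p N S₀ := by
  intro c hc
  rw [mem_quotSelmer_iff] at hc
  rw [mem_datumSelmer_iff]
  exact ⟨hc.1, fun v hv σ ↦ unramifiedKer_le_greenbergKer (N v hv) (hc.2 v hv σ)⟩

/-- **`i_*` preserves "unramified at every finite place outside `S₀`"** (`conjH1_subH1`,
`subH1_mem_unramifiedKer`, `subH1_mem_unramifiedOutside`). [cite: GreenbergVatsal2000, §2 p. 17] -/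
theorem subH1_mem_quotSelmer {a : subgroupH1 H Φ} (ha : a ∈ quotSelmer H Φ p S₀) :
    subH1 H i hi a ∈ quotSelmer H M p S₀ := by
  rw [mem_quotSelmer_iff] at ha ⊢
  refine ⟨subH1_mem_unramifiedOutside (hi := hi) p S₀ ha.1, fun v hv σ ↦ ?_⟩
  rw [conjH1_subH1]
  exact subH1_mem_unramifiedKer (hi := hi) v (ha.2 v hv σ)

/-- **The Φ-side inclusion `i_* S^{Σ₀}_Φ(L) ⊆ S^{Σ₀}_M(L)` for ANY Greenberg data on `M`**: classes
of the sub-module `Φ` that are unramified everywhere outside `S₀` (INCLUDING at `v ∣ p`) map to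
Greenberg–Vatsal Selmer classes of `M`, whatever `M⁺_v` is. This is the devissage of GV pp. 28–29
read on the SUB-module with the UNRAMIFIED condition — the shape needed when the rational line is
unramified at `p` (Greenberg's Prop. 5.10 case 2, and the étale end of a type-A class), where the
tree's case-1 lemma `subH1_mem_datumSelmer` (`im i ⊆ M⁺_v`) does not apply.
[cite: GreenbergVatsal2000, §2 pp. 28–29] [cite: GreenbergLNM1716, Prop. 5.10 (proof, PDF p. 148)] -/
theorem subH1_mem_datumSelmer_of_mem_quotSelmer {a : subgroupH1 H Φ}
    (ha : a ∈ quotSelmer H Φ p S₀) : subH1 H i hi a ∈ datumSelmer H M p N S₀ :=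
  quotSelmer_le_datumSelmer (subH1_mem_quotSelmer (hi := hi) ha)

/-- **Exactness of the Φ-side for a sub-module complementary to `M⁺`**: if `Φ → M/M⁺_v` is
bijective at every `v ∣ p` (`Φ ∩ M⁺_v = 0`, `#Φ = #(M/M⁺_v)`), then for `a ∈ H¹(ℚ_Σ/L, Φ)`:
`i_* a ∈ S^{Σ₀}_M(L) ↔ a ∈ S^{Σ₀}_Φ(L) = H¹_unr` (`⇐` by the inclusion above; `⇒` by the tree's
`mem_unramifiedKer_of_subH1_mem_greenbergKer`: `H¹(H ⊓ I_v, Φ) → H¹(H ⊓ I_v, M/M⁺_v)` is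
injective). [cite: GreenbergLNM1716, Prop. 5.10 (proof, PDF p. 148)] [cite: GreenbergVatsal2000, §2 pp. 28–29] -/
theorem subH1_mem_datumSelmer_iff_of_bijective
    (hN : ∀ v hv, Function.Bijective fun x : Φ ↦ (N v hv).grMk (i x))
    {a : subgroupH1 H Φ} (ha : a ∈ unramifiedOutside H Φ p S₀) :
    subH1 H i hi a ∈ datumSelmer H M p N S₀ ↔ a ∈ quotSelmer H Φ p S₀ := by
  refine ⟨fun h ↦ ?_, subH1_mem_datumSelmer_of_mem_quotSelmer (hi := hi)⟩
  rw [mem_quotSelmer_iff]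
  refine ⟨ha, fun v hv σ ↦ ?_⟩
  refine mem_unramifiedKer_of_subH1_mem_greenbergKer (hi := hi) (N v hv) (hN v hv) ?_
  rw [← conjH1_subH1]
  exact ((mem_datumSelmer_iff _).1 h).2 v hv σ

end NumberField

/-! ## §2. `E/ℚ`: a rational line and the residual Selmer group `S^{Σ₀}_{E[p]}(L)` -/

section Curve

open WeierstrassCurve Literature.NumberTheory.EllipticCurves.Rank1Residual
  Summit.BirchSwinnertonDyer.Rank1Residual.X2.GreenbergVatsalTorsion
  Summit.BirchSwinnertonDyer.Rank1Residual.X2.GreenbergVatsalTateDatumCofree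
  Summit.BirchSwinnertonDyer.Rank1Residual.X2.ResidualDevissageModules
  Summit.BirchSwinnertonDyer.Rank1Residual.X2.ResidualDevissageLine

variable {W : WeierstrassCurve ℚ} {p : ℕ} [hp : Fact p.Prime]
variable {Φ₀ : AddSubgroup (geomTorsion W (p : ℤ))} (hΦ : IsRationalLine W p Φ₀)

/-- **Everywhere-unramified `Φ₀`-classes are residual Greenberg–Vatsal Selmer classes of `E[p]`**,
for ANY rational line `Φ₀ ≤ E[p]`, ANY Greenberg data `L` on `E[p^∞]` above `p` (reduction datum,
Tate datum, …), any `S₀`, any normal `H ≤ Γ_ℚ` (e.g. `Gal(ℚ̄/ℚ_∞)`):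
`incl_* S^{Σ₀}_{Φ₀}(L) ⊆ S^{Σ₀}_{E[p]}(L)`. [cite: GreenbergVatsal2000, §2 pp. 28–29] -/
theorem incl_mem_gvSelmer_of_mem_quotSelmer (L : Data ℚ (W.geomPrimaryTorsion p) p)
    (S₀ : Set (HeightOneSpectrum (𝓞 ℚ))) (H : Subgroup (absoluteGaloisGroup ℚ)) [H.Normal]
    {a : subgroupH1 H (lineSub Φ₀ hΦ).Sub} (ha : a ∈ quotSelmer H (lineSub Φ₀ hΦ).Sub p S₀) :
    subH1 H (lineSub Φ₀ hΦ).incl (lineSub Φ₀ hΦ).incl_smul a ∈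
      gvSelmer H ↥((↥(W.geomPrimaryTorsion p))[(p : ℤ)]) p (torsionData L p) S₀ := by
  rw [gvSelmer_eq_datumSelmer]
  exact subH1_mem_datumSelmer_of_mem_quotSelmer (hi := (lineSub Φ₀ hΦ).incl_smul) ha

variable [W.IsElliptic]

/-- **For a rational line UNRAMIFIED at `p`, the `Φ₀`-classes inside `S^{Σ₀}_{E[p]}(L)` are EXACTLY
`S^{Σ₀}_{Φ₀}(L) = H¹_unr`** — the Φ-side of the devissage at the étale end of a type-A class (and in
Greenberg's Prop. 5.10 case 2): `Φ₀ ∩ C[p] = 0` and `Φ₀ ≅ E[p]/C[p]`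
(`bijective_grMk_incl_of_lineUnramifiedAt`, for data with residual line of order `p` inertially
generated: the reduction datum at good ordinary `p > 2`, the Tate datum at `p ‖ N`), so Greenberg's
condition on `incl_* a` at `v ∣ p` is precisely "`a` unramified at `v`". What this does NOT give
(MEMO §3): any control of the QUOTIENT side, whose relaxed Selmer group has `(Λ/p)`-corank `1` when
the quotient character is odd (LNM 1716 Lemma 5.9). [cite: GreenbergLNM1716, Prop. 5.10 (proof, PDF p. 148) and Lemma 5.9]
[cite: GreenbergVatsal2000, §2 pp. 28–29] -/
theorem incl_mem_gvSelmer_iff_of_lineUnramifiedAt (hunr : LineUnramifiedAt W p Φ₀)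
    (L : Data ℚ (W.geomPrimaryTorsion p) p)
    (hgen : ∀ (v : HeightOneSpectrum (𝓞 ℚ)) (hv : ((p : ℕ) : 𝓞 ℚ) ∈ v.asIdeal),
      ∀ c ∈ (torsionData L p v hv).plus, ∃ τ ∈ inertia v,
        ∃ c' ∈ (torsionData L p v hv).plus, τ • c' - c' = c)
    (hcard : ∀ (v : HeightOneSpectrum (𝓞 ℚ)) (hv : ((p : ℕ) : 𝓞 ℚ) ∈ v.asIdeal),
      Nat.card ↥((L v hv).plus ⊓ (↥(W.geomPrimaryTorsion p))[(p : ℤ)]) = p)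
    (S₀ : Set (HeightOneSpectrum (𝓞 ℚ))) (H : Subgroup (absoluteGaloisGroup ℚ)) [H.Normal]
    {a : subgroupH1 H (lineSub Φ₀ hΦ).Sub}
    (ha : a ∈ GreenbergVatsal2000.unramifiedOutside H (lineSub Φ₀ hΦ).Sub p S₀) :
    subH1 H (lineSub Φ₀ hΦ).incl (lineSub Φ₀ hΦ).incl_smul a ∈
        gvSelmer H ↥((↥(W.geomPrimaryTorsion p))[(p : ℤ)]) p (torsionData L p) S₀ ↔
      a ∈ quotSelmer H (lineSub Φ₀ hΦ).Sub p S₀ := by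
  rw [gvSelmer_eq_datumSelmer]
  exact subH1_mem_datumSelmer_iff_of_bijective (hi := (lineSub Φ₀ hΦ).incl_smul)
    (fun v hv ↦ bijective_grMk_incl_of_lineUnramifiedAt hΦ hunr hv (L v hv) (hgen v hv) (hcard v hv))
    ha

end Curve

end Summit.BirchSwinnertonDyer.BirchSwinnertonDyer.Theorems.EisensteinPrimesUnramifiedLineSelmerClasses

end
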